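import Summits.AnomalousDissipation.AnomalousDissipation.Theorems.BaireTransferDenseLoudDesignerForcesLine
import Literature.Analysis.FunctionSpaces.TorusSpaceTime
import Literature.Analysis.FunctionSpaces.TorusCalculusProofs
import Literature.Analysis.FunctionSpaces.TorusFourierCalculus
import Literature.Analysis.FluidPDE.LongTimeAveragePeriodic

/-!
# Stub `stub_boostBudgets` of the line `galilean-detuning-body-force-grid`
# (crux stmt-AnomalousDissipation-1143, `BaireTransfer.DenseLoudDesignerForces`)

The exact BUDGET BOOKKEEPING of a Galilean boost `u t x = V + w t (x - [tV])` (`boost V w`) of a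
momentum-free fluctuation `w` (`∫ w t = 0` for all `t`) by a LATTICE-COMMENSURATE drift
(`T • V = n ∈ ℤ³`, so that `u` is `T`-periodic together with `w`, `boost_periodic`):

* ENERGY: `meanEnergy (boost V w) = ‖V‖² + meanEnergy w`.  Slice-wise, by Haar invariance of the
  volume of `T³` and `‖V + w‖² = ‖V‖² + 2⟪V, w⟫ + ‖w‖²`, `∫ ‖u t‖² = ‖V‖² + 2⟪V, ∫ w t⟫ + ∫ ‖w t‖²
  = ‖V‖² + ∫ ‖w t‖²` (`integral_norm_sq_boost`); both fields being `T`-periodic, their mean energies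
  are honest period means (`meanEnergy_eq_of_periodic`), and the period mean of a constant plus a
  continuous function splits.
* DISSIPATION: `meanDissipation ν (boost V w) = meanDissipation ν w`, pointwise in time and with no
  periodicity: `∂ᵢ (V + w t (· - a)) = (∂ᵢ w t)(· - a)` (`partialDeriv_boost`), so
  `‖∇u t‖₂² = ‖∇w t‖₂²` by Haar invariance (`gradNormSq_boost`), transported to the spectral
  gradient norm of `meanDissipation` through `eGradNormSq_eq_ofReal_gradNormSq` on smooth slices.

This is hypothesis `hbud` of `mem_loudSet_of_swept_witness` / `DenseLoudDesignerForces_of` in the Line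
module `Theorems/BaireTransferDenseLoudDesignerForcesLine.lean`.

References: Frisch, *Turbulence* (1995) §5.2 (Galilean invariance; grid turbulence); Doering–Foias,
J. Fluid Mech. 467 (2002) §2 (the budgets `⟨‖u‖₂²⟩`, `ν⟨‖∇u‖₂²⟩`).
-/

-- `Summit.<Summit>.<Problem>` is the tree's mandated summit-side namespace (CONVENTIONS §2); for this
-- single-conjunct summit the two coincide, so the duplicate is deliberate.
set_option linter.dupNamespace false

noncomputable section

open scoped BigOperators Topology InnerProductSpace
open Filter Set Function MeasureTheory

-- sub-namespace of the Line vocabulary namespace, so `sweptForce`, `boost`, `goodDrifts`, … resolve unqualified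
namespace Summit.AnomalousDissipation.AnomalousDissipation.Theorems.DenseLoudDesignerForces.Galilean.BoostBudgets

open Literature.Analysis.FunctionSpaces Literature.Analysis.FluidPDE
open Summit.AnomalousDissipation.AnomalousDissipation.Theses.BaireTransfer
open Summit.AnomalousDissipation.AnomalousDissipation.Theorems.DenseLoudDesignerForces.Negative

/-- The flat unit torus `T³`. -/
local notation "𝕋³" => UnitAddTorus (Fin 3)
/-- Real velocity values. -/
local notation "ℝ³" => EuclideanSpace ℝ (Fin 3)
/-- Complex Fourier coefficient values. -/
local notation "ℂ³" => EuclideanSpace ℂ (Fin 3)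
/-- The frequency / drift lattice `ℤ³`. -/
local notation "ℤ³" => Fin 3 → ℤ

/-! ## Slice energy of a boost -/

/-- **Slice energy of a boost**: for a smooth momentum-free slice, `∫ ‖V + w t (x - [tV])‖² dx =
‖V‖² + ∫ ‖w t x‖² dx` (Haar invariance, `‖V + w‖² = ‖V‖² + 2⟪V, w⟫ + ‖w‖²`, `∫ w t = 0`). [folklore] -/
theorem integral_norm_sq_boost {V : ℝ³} {w : ℝ → 𝕋³ → ℝ³} (hw : Torus.IsSmoothSpaceTimeOn univ w)
    (hmean : ∀ t, Torus.HasZeroMean (w t)) (t : ℝ) :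
    ∫ x, ‖boost V w t x‖ ^ 2 = ‖V‖ ^ 2 + ∫ x, ‖w t x‖ ^ 2 := by
  have hs : Torus.IsSmooth (w t) := hw.isSmooth_slice (mem_univ t)
  have h1 : ∫ x, ‖boost V w t x‖ ^ 2 = ∫ x, ‖V + w t x‖ ^ 2 :=
    integral_sub_right_eq_self (μ := (volume : Measure 𝕋³)) (fun y => ‖V + w t y‖ ^ 2)
      (Torus.proj (t • V))
  have h2 : (fun x => ‖V + w t x‖ ^ 2) = fun x => (‖V‖ ^ 2 + 2 * ⟪V, w t x⟫_ℝ) + ‖w t x‖ ^ 2 := by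
    funext x
    exact norm_add_sq_real V (w t x)
  have hiV : Integrable (fun _ : 𝕋³ => ‖V‖ ^ 2) (volume : Measure 𝕋³) := integrable_const _
  have hiI : Integrable (fun x => 2 * ⟪V, w t x⟫_ℝ) (volume : Measure 𝕋³) :=
    ((Torus.isSmooth_const V).inner hs).integrable.const_mul 2
  have hiVI : Integrable (fun x => ‖V‖ ^ 2 + 2 * ⟪V, w t x⟫_ℝ) (volume : Measure 𝕋³) := hiV.add hiI
  have hiN : Integrable (fun x => ‖w t x‖ ^ 2) (volume : Measure 𝕋³) := hs.norm_sq.integrable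
  have h0 : ∫ x, w t x = 0 := hmean t
  rw [h1, h2, integral_add hiVI hiN, integral_add hiV hiI, integral_const, probReal_univ,
    one_smul, integral_const_mul, integral_inner hs.integrable V, h0, inner_zero_right, mul_zero, add_zero]

/-! ## Slice dissipation of a boost -/

/-- Partial derivatives of `x ↦ c + g (x - a)` are those of `g` at `x - a` (`deriv_const_add`, no
differentiability needed). [folklore] -/
theorem partialDeriv_const_add_comp_sub {F : Type*} [NormedAddCommGroup F] [NormedSpace ℝ F]
    (i : Fin 3) (c : F) (g : 𝕋³ → F) (a x : 𝕋³) :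
    Torus.partialDeriv i (fun z => c + g (z - a)) x = Torus.partialDeriv i g (x - a) := by
  simp only [Torus.partialDeriv, Torus.lineDeriv, add_sub_right_comm, deriv_const_add]

/-- Partial derivatives of a boost slice: `∂ᵢ (boost V w t) x = ∂ᵢ (w t) (x - [tV])`. [folklore] -/
theorem partialDeriv_boost (V : ℝ³) (w : ℝ → 𝕋³ → ℝ³) (t : ℝ) (i : Fin 3) (x : 𝕋³) :
    Torus.partialDeriv i (boost V w t) x = Torus.partialDeriv i (w t) (x - Torus.proj (t • V)) :=
  partialDeriv_const_add_comp_sub i V (w t) (Torus.proj (t • V)) x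

/-- **Slice gradient norm of a boost**: `‖∇(boost V w t)‖₂² = ‖∇(w t)‖₂²` (Haar invariance). [folklore] -/
theorem gradNormSq_boost (V : ℝ³) (w : ℝ → 𝕋³ → ℝ³) (t : ℝ) :
    Torus.gradNormSq (boost V w t) = Torus.gradNormSq (w t) := by
  unfold Torus.gradNormSq
  have h : (fun x => ∑ i, ‖Torus.partialDeriv i (boost V w t) x‖ ^ 2) =
      fun x => (fun z => ∑ i, ‖Torus.partialDeriv i (w t) z‖ ^ 2) (x - Torus.proj (t • V)) := by
    funext x
    simp only [partialDeriv_boost]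
  rw [h]
  exact integral_sub_right_eq_self (μ := (volume : Measure 𝕋³))
    (fun z => ∑ i, ‖Torus.partialDeriv i (w t) z‖ ^ 2) (Torus.proj (t • V))

/-- **Slice spectral gradient norm of a boost** of a jointly smooth fluctuation:
`eGradNormSq (boost V w t) = eGradNormSq (w t)` (both slices are smooth — the boost slice is a
constant plus a translate of `w t` — so both sides are `ofReal` of the derivative-based norms, equal by
`gradNormSq_boost`). [folklore] -/
theorem eGradNormSq_boost {V : ℝ³} {w : ℝ → 𝕋³ → ℝ³} (hw : Torus.IsSmoothSpaceTimeOn univ w) (t : ℝ) :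
    Torus.eGradNormSq (boost V w t) = Torus.eGradNormSq (w t) := by
  have hs : Torus.IsSmooth (w t) := hw.isSmooth_slice (mem_univ t)
  have hsb : Torus.IsSmooth (boost V w t) := by
    have h : boost V w t = (fun _ : 𝕋³ => V) + fun x => w t (x + -Torus.proj (t • V)) := by
      funext x
      show V + w t (x - Torus.proj (t • V)) = V + w t (x + -Torus.proj (t • V))
      rw [sub_eq_add_neg]
    rw [h]
    exact (Torus.isSmooth_const V).add (hs.comp_add_right _)
  rw [Torus.eGradNormSq_eq_ofReal_gradNormSq hsb, Torus.eGradNormSq_eq_ofReal_gradNormSq hs,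
    gradNormSq_boost]

/-- **Dissipation of a boost** (no periodicity needed): `meanDissipation ν (boost V w) =
meanDissipation ν w` for every jointly smooth `w`. [folklore] -/
theorem meanDissipation_boost (ν : ℝ) {V : ℝ³} {w : ℝ → 𝕋³ → ℝ³}
    (hw : Torus.IsSmoothSpaceTimeOn univ w) : meanDissipation ν (boost V w) = meanDissipation ν w := by
  unfold meanDissipation
  congr 1
  funext t
  rw [eGradNormSq_boost hw t]

/-! ## Mean energy of a periodic boost -/

/-- **Energy of a lattice-commensurate boost**: for `T • V = n ∈ ℤ³`, `0 < T`, and a jointly smooth,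
`T`-periodic, momentum-free `w`, `meanEnergy (boost V w) = ‖V‖² + meanEnergy w` (both mean energies are
period means over `[0, T]`; slice-wise `integral_norm_sq_boost`). [folklore] -/
theorem meanEnergy_boost {V : ℝ³} {n : ℤ³} {T : ℝ} {w : ℝ → 𝕋³ → ℝ³} (hT : 0 < T)
    (hTV : T • V = Torus.latticeVec n) (hw : Torus.IsSmoothSpaceTimeOn univ w)
    (hper : Function.Periodic w T) (hmean : ∀ t, Torus.HasZeroMean (w t)) :
    meanEnergy (boost V w) = ‖V‖ ^ 2 + meanEnergy w := by
  have hperb : Function.Periodic (boost V w) T := boost_periodic hTV hper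
  have he_st : Torus.IsSmoothSpaceTimeOn univ (fun r x => ‖w r x‖ ^ 2) := by
    change ContDiffOn ℝ _ (fun z => ‖Torus.stLift w z‖ ^ 2) _
    exact hw.norm_sq ℝ
  have he_cont : Continuous fun r => ∫ x, ‖w r x‖ ^ 2 :=
    continuousOn_univ.1 (he_st.continuousOn_integral convex_univ)
  have he_int : IntervalIntegrable (fun r => ∫ x, ‖w r x‖ ^ 2) volume 0 T :=
    he_cont.intervalIntegrable _ _
  have hcongr : ∫ t in (0 : ℝ)..T, ∫ x, ‖boost V w t x‖ ^ 2 =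
      ∫ t in (0 : ℝ)..T, ((‖V‖ ^ 2) + ∫ x, ‖w t x‖ ^ 2) :=
    intervalIntegral.integral_congr fun t _ => integral_norm_sq_boost hw hmean t
  rw [meanEnergy_eq_of_periodic hperb hT, meanEnergy_eq_of_periodic hper hT, hcongr,
    intervalIntegral.integral_add intervalIntegrable_const he_int, intervalIntegral.integral_const,
    sub_zero, smul_eq_mul, mul_add, ← mul_assoc, inv_mul_cancel₀ hT.ne', one_mul]

/-! ## The stub -/

/-- **Budgets of a Galilean boost** (the registered stub `stub_boostBudgets` of the line
`galilean-detuning-body-force-grid`, hypothesis `hbud` of `DenseLoudDesignerForces_of`): for a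
lattice-commensurate drift `T • V = n ∈ ℤ³` (`0 < T`) and a jointly smooth, `T`-periodic, momentum-free
fluctuation `w`, the boost `V + w t (· - [tV])` has mean energy `‖V‖² + meanEnergy w` and the same mean
dissipation as `w`. [folklore] -/
theorem stub_boostBudgets : ∀ (ν : ℝ) (V : ℝ³) (n : ℤ³) (T : ℝ) (w : ℝ → 𝕋³ → ℝ³), 0 < T → T • V = Torus.latticeVec n → Torus.IsSmoothSpaceTimeOn Set.univ w → Function.Periodic w T → (∀ t, Torus.HasZeroMean (w t)) → meanEnergy (boost V w) = ‖V‖ ^ 2 + meanEnergy w ∧ meanDissipation ν (boost V w) = meanDissipation ν w :=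
  fun ν _ _ _ _ hT hTV hw hper hmean =>
    ⟨meanEnergy_boost hT hTV hw hper hmean, meanDissipation_boost ν hw⟩

end Summit.AnomalousDissipation.AnomalousDissipation.Theorems.DenseLoudDesignerForces.Galilean.BoostBudgets

end
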